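import Summits.ResolutionOfSingularities.ResolutionOfSingularities.Theorems.EquisingularLiftEquisingularLiftNatClusterPointCover
import Summits.ResolutionOfSingularities.ResolutionOfSingularities.Theorems.EquisingularLiftEquisingularLiftNatSectionFrameLift
import Summits.ResolutionOfSingularities.ResolutionOfSingularities.Theorems.EquisingularLiftEquisingularLiftNatCarrierDeltaComapFrame
import Summits.ResolutionOfSingularities.ResolutionOfSingularities.Theorems.EquisingularLiftEquisingularLiftNatCarrierDeltaSectionFrameDim
import Summits.ResolutionOfSingularities.ResolutionOfSingularities.Theorems.EquisingularLiftEquisingularLiftNatSquarefreeInitialForm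
import Summits.ResolutionOfSingularities.ResolutionOfSingularities.Theorems.EquisingularLiftEquisingularLiftNatClusterLift
import Literature.Computability.AlgebraicComplexity.DeterminantalConormalBoundPlane
import HarnessLib

/-!
# [OURS · L1 W4.5(b) · EL♮(3)] (δ) D6 INV″-BASE, preparations: (a) a form with RADICAL dehomogenisations is SQUARE-FREE (the `hgsq` input of
# res-L1-w45b-stub-3's D1 from `ReducedConeForm`); (b) the SECTION-FRAME LIFT in the model square (stalk corollary of res-D-pv-051's ring lemma
# p550981); (c) a cluster member lying on the carrier curve has order `≥ 1`

Crux chain w45b (cell `res-hironaka`, slot W4.5(b)), working crux **EL♮** = stmt-ResolutionOfSingularities-20038, child **EL♮(3)** =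
stmt-ResolutionOfSingularities-20148, route EquisingularLift, line `sections`, registered stub `stub_elnat_tcPlusPlusPointResolution` (v2);
brick **(δ) D6 INV″-BASE** (res-L1-w45b-stub-3 `DELTA-PLAN.md`; res-L1-w45b-plan-1 BOOKING 2026-08-27T16:20:41Z: D5/D6 := res-type-100).
HONEST FRAMING: OURS; NOT a statement of any manuscript; AI-written, weaker than expert review. No `sorry`; standard axioms. DEF-FREE.
`--supports stmt-ResolutionOfSingularities-20148 --as helper`.

WHAT (namespace `…Cruxes.EquisingularLiftNat.Sections`).
* `isUnit_dehomogenize_of_mul_self_dvd` / **`squarefree_of_isHomogeneous_of_isRadical_dehomogenize`** — over a field, a non-zero FORM in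
  `≥ 2` variables all of whose dehomogenisations generate RADICAL ideals is square-free (`ReducedConeForm` (R2) ⇒ D1's `hgsq`): a square factor
  `x` is a form (Literature `isHomogeneous_of_dvd_isHomogeneous`), each `x(T_j := 1)` is a unit (radicality in a domain), so `x = c_j T_j^e` for two
  different `j` (injectivity of dehomogenisation on forms, res-type-100 …NatSquarefreeInitialForm) — impossible unless `e = 0`.
* **`exists_sectionFrame_lift_model`** — in the model square `j : F₁ → X′` over `O ↠ k` with a section `s` through `j x` (`𝒪_{X′,j x}` regular):
  every frame `c̄ : Fin m → 𝒪_{F₁,x}` of `𝔪_x` LIFTS to `c : Fin m → 𝒪_{X′,j x}` with `(c) = 𝓘(s)_{j x}` and `j♯ c = c̄` (res-D-pv-051's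
  `exists_frame_lift_of_torsionFree` p550981 at `I = 𝓘(s)_{j x}`, `ϖ_R = ι ϖ`: `I ⊔ (ϖ_R) = 𝔪` by any section frame, `R/I ≅ O` torsion-free,
  `ker j♯ = (ϖ_R)` by res-type-100's `ker_stalkMap_model_le` / `stalkMap_model_varpi`).
* **`one_le_of_clusterPoint_mem_carrierTrace`** — in res-L1-w45b-stub-2's `finite_badPrimes…` currency: a point `y′` over `x` presented on the
  chart `c̄_i` with coordinates `w` lifting `a`, lying ON the carrier curve `Z₂`, has `ḡ(T_i := 1)(a) = 0`; so the exact-order exponent `m` of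
  `FatCluster` at that member is `≥ 1` (the `hm1` input of res-L1-w45b-stub-3's D4 `tcPlus_centredPackage_clusterPoint`).

References: res-D-pv-051 …NatSectionFrameLift (p550981); res-type-100 …NatCarrierDeltaComapFrame, …NatSquarefreeInitialForm, D3 parts 1/2b;
res-L1-w45b-stub-3 …NatClusterLift (p524424); Literature …DeterminantalConormalBoundPlane (`isHomogeneous_of_dvd_isHomogeneous`)
[cite: Matsumura1987, Thm. 14.2; StacksProject, Tag 0804].
-/

set_option linter.dupNamespace false -- mandated namespace `Summit.<Summit>.<Problem>` of this single-conjunct summit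
set_option linter.overlappingInstances false -- signatures carry `[IsDomain O] [IsDiscreteValuationRing O]`

noncomputable section

open CategoryTheory CategoryTheory.Limits AlgebraicGeometry TopologicalSpace IsLocalRing MvPolynomial
open Literature.AlgebraicGeometry.Resolution
open AlgebraicGeometry.Scheme.IdealSheafData
open Summit.ResolutionOfSingularities.ResolutionOfSingularities.Theorems.EquisingularLiftNat.ClusterLift

namespace Summit.ResolutionOfSingularities.ResolutionOfSingularities.Cruxes.EquisingularLiftNat.Sections

/-! ## (a) Radical dehomogenisations ⇒ square-free form -/

section Squarefree

variable {k : Type} [Field k] {σ : Type} [DecidableEq σ]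

/-- If `x·x ∣ g` and `(g(T_j := 1))` is a radical ideal with `g(T_j := 1) ≠ 0`, then `x(T_j := 1)` is a unit. [folklore] -/
theorem isUnit_dehomogenize_of_mul_self_dvd (j : σ) {g x : MvPolynomial σ k} (hx : x * x ∣ g)
    (hR : (Ideal.span {dehomogenize j g}).IsRadical) (hg0 : dehomogenize j g ≠ 0) : IsUnit (dehomogenize j x) := by
  obtain ⟨m, hm⟩ := hx
  have hgj : dehomogenize j g = dehomogenize j x * dehomogenize j x * dehomogenize j m := by rw [hm, map_mul, map_mul]
  -- `y = x_j m_j` has `y² = g_j m_j ∈ (g_j)`, so `y ∈ (g_j)`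
  have hy : dehomogenize j x * dehomogenize j m ∈ Ideal.span {dehomogenize j g} :=
    hR ⟨2, Ideal.mem_span_singleton'.mpr ⟨dehomogenize j m, by rw [hgj]; ring⟩⟩
  obtain ⟨r, hr⟩ := Ideal.mem_span_singleton'.mp hy
  have hne : dehomogenize j x * dehomogenize j m ≠ 0 := fun h => hg0 (by
    rw [hgj, mul_assoc, h, mul_zero])
  have h1 : dehomogenize j x * dehomogenize j m * (1 - r * dehomogenize j x) = 0 := by
    rw [mul_sub, mul_one, sub_eq_zero, hgj] at *
    linear_combination -hr
  have h2 : 1 - r * dehomogenize j x = 0 := (mul_eq_zero.mp h1).resolve_left hne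
  exact isUnit_iff_exists_inv.mpr ⟨r, by linear_combination -h2⟩

/-- **A non-zero form in at least two variables whose dehomogenisations generate radical ideals is square-free.** (`ReducedConeForm` (R2) ⇒ the
`hgsq` input of res-L1-w45b-stub-3's `exists_clusterConeLift_subset`.) [folklore] -/
theorem squarefree_of_isHomogeneous_of_isRadical_dehomogenize {g : MvPolynomial σ k} {d : ℕ} (hg : g.IsHomogeneous d)
    (hg0 : g ≠ 0) (j₀ j₁ : σ) (hj : j₀ ≠ j₁) (hR : ∀ j, (Ideal.span {dehomogenize j g}).IsRadical) : Squarefree g := by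
  intro x hx
  have hxh : x.IsHomogeneous x.totalDegree :=
    Literature.Computability.AlgebraicComplexity.DeterminantalConormal.isHomogeneous_of_dvd_isHomogeneous hg hg0
      (dvd_trans (dvd_mul_right x x) hx)
  have hunit : ∀ j, IsUnit (dehomogenize j x) := fun j =>
    isUnit_dehomogenize_of_mul_self_dvd j hx (hR j) (dehomogenize_ne_zero_of_isHomogeneous j hg hg0)
  -- each `x(T_j := 1)` is a non-zero constant `c_j`, so `x = c_j T_j^e`
  have hconst : ∀ j, ∃ c : k, c ≠ 0 ∧ x = C c * X j ^ x.totalDegree := by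
    intro j
    obtain ⟨hu0, hdeg⟩ := MvPolynomial.isUnit_iff_totalDegree_of_isReduced.mp (hunit j)
    refine ⟨(dehomogenize j x).coeff 0, hu0.ne_zero, ?_⟩
    refine eq_of_isHomogeneous_of_dehomogenize_eq j hxh (isHomogeneous_C_mul_X_pow _ j _) ?_
    rw [map_mul, map_pow, dehomogenize_X_self, one_pow, mul_one]
    change dehomogenize j x = MvPolynomial.aeval _ (C _)
    rw [MvPolynomial.algHom_C, MvPolynomial.algebraMap_eq]
    exact totalDegree_eq_zero_iff_eq_C.mp hdeg
  by_cases he : x.totalDegree = 0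
  · obtain ⟨c, hc0, hxc⟩ := hconst j₀
    rw [he, pow_zero, mul_one] at hxc
    rw [hxc]
    exact (MvPolynomial.isUnit_iff_eq_C_of_isReduced).mpr ⟨c, hc0.isUnit, rfl⟩
  · exfalso
    obtain ⟨c₀, hc₀, h₀⟩ := hconst j₀
    obtain ⟨c₁, -, h₁⟩ := hconst j₁
    have hcoeff := congrArg (MvPolynomial.coeff (Finsupp.single j₀ x.totalDegree)) (h₀.symm.trans h₁)
    rw [coeff_C_mul, coeff_C_mul, coeff_X_pow, coeff_X_pow, if_pos rfl, mul_one, if_neg, mul_zero] at hcoeff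
    · exact hc₀ hcoeff
    · intro h
      have := Finsupp.single_eq_single_iff _ _ _ _ |>.mp h
      rcases this with ⟨h1, -⟩ | ⟨h1, -⟩
      · exact hj h1.symm
      · exact he h1

end Squarefree

/-! ## (b) The section-frame lift in the model square -/

variable (O : Type) [CommRing O] [IsDomain O] [IsDiscreteValuationRing O]

set_option maxHeartbeats 400000 in -- stalk-level bookkeeping over the model square
/-- **The section-frame lift in the model square** (see the module docstring). [cite: Matsumura1987, Thm. 14.2] [OURS · L1 W4.5b] (δ) D6 prep;
NOT a statement of the manuscript. -/
theorem exists_sectionFrame_lift_model (k : Type) [Field k] (θ : O →+* k) (hθ : Function.Surjective θ)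
    {X' F₁ : Scheme.{0}} (r' : X' ⟶ Spec (.of O)) [IsSeparated r'] [LocallyOfFiniteType r'] [IsLocallyNoetherian X']
    (s : Spec (.of O) ⟶ X') (hs : s ≫ r' = 𝟙 _) (j : F₁ ⟶ X') (t : F₁ ⟶ Spec (.of k))
    (hsq : IsPullback j t r' (Spec.map (CommRingCat.ofHom θ))) (x : F₁) (hss : s (IsLocalRing.closedPoint O) = j x)
    (hreg : IsRegularLocalRing (X'.presheaf.stalk (j x))) (ϖ : O) (hϖ : Irreducible ϖ) {m : ℕ}
    (cb : Fin m → F₁.presheaf.stalk x) (hcb : Ideal.span (Set.range cb) = maximalIdeal (F₁.presheaf.stalk x)) :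
    ∃ c : Fin m → X'.presheaf.stalk (j x), Ideal.span (Set.range c) = stalkIdeal s.ker (j x) ∧
      ∀ i, (j.stalkMap x).hom (c i) = cb i := by
  classical
  haveI := hreg
  haveI : IsClosedImmersion (Spec.map (CommRingCat.ofHom θ)) := IsClosedImmersion.spec_of_surjective _ hθ
  haveI : IsClosedImmersion j := MorphismProperty.IsStableUnderBaseChange.of_isPullback hsq.flip inferInstance
  set R := X'.presheaf.stalk (j x) with hR
  set I : Ideal R := stalkIdeal s.ker (j x) with hIdef
  set ϖR : R := (X'.presheaf.Γgerm (j x)).hom (r'.appTop.hom ((Scheme.ΓSpecIso (.of O)).inv.hom ϖ)) with hϖR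
  have hϖO : ϖ ∈ maximalIdeal O := by rw [hϖ.maximalIdeal_eq]; exact Ideal.mem_span_singleton_self ϖ
  -- a section frame gives `I ⊔ (ϖ_R) = 𝔪` and `R/I ≅ O`
  obtain ⟨n, c₀, θ₀, hc₀I, -, -, hθ₀, h𝔪₀, hϖc₀, -⟩ := exists_sectionFrame_forall_dim_at O r' s hs (j x) hss hreg ϖ hϖ
  have hsup : I ⊔ Ideal.span {ϖR} = maximalIdeal R := by rw [hIdef, ← hc₀I]; exact h𝔪₀
  have htf : ∀ r : R, ϖR * r ∈ I → r ∈ I := by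
    intro r hr
    rw [hIdef, ← hc₀I] at hr ⊢
    have h1 : θ₀ (Ideal.Quotient.mk _ (ϖR * r)) = 0 := by
      rw [Ideal.Quotient.eq_zero_iff_mem.mpr hr, map_zero]
    rw [map_mul, map_mul, hϖR, hθ₀] at h1
    have h2 : θ₀ (Ideal.Quotient.mk _ r) = 0 := (mul_eq_zero.mp h1).resolve_left hϖ.ne_zero
    rw [← Ideal.Quotient.eq_zero_iff_mem]
    exact θ₀.injective (h2.trans (map_zero θ₀).symm)
  have hIfg : I.FG := (inferInstance : IsNoetherianRing R).noetherian I
  -- `ker j♯ = (ϖ_R)`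
  have hkerj : RingHom.ker (j.stalkMap x).hom = Ideal.span {ϖR} := by
    apply le_antisymm (ker_stalkMap_model_le O k θ hθ r' j t hsq x ϖ hϖ)
    rw [Ideal.span_singleton_le_iff_mem, RingHom.mem_ker]
    exact stalkMap_model_varpi θ hθ r' j t hsq x ϖ hϖO
  -- preimages of the downstairs frame, read modulo `(ϖ_R)`
  choose ct hct using fun i => stalkMap_model_surjective θ hθ r' j t hsq x (cb i)
  have hcb' : Ideal.span (Set.range fun i => Ideal.Quotient.mk (Ideal.span {ϖR}) (ct i)) =
      (maximalIdeal R).map (Ideal.Quotient.mk (Ideal.span {ϖR})) := by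
    apply le_antisymm
    · rw [Ideal.span_le]
      rintro _ ⟨i, rfl⟩
      apply Ideal.mem_map_of_mem
      have : (j.stalkMap x).hom (ct i) ∈ maximalIdeal (F₁.presheaf.stalk x) := by
        rw [hct, ← hcb]; exact Ideal.subset_span (Set.mem_range_self i)
      rwa [← IsLocalRing.maximalIdeal_comap (j.stalkMap x).hom, Ideal.mem_comap]
    · rw [Ideal.map_le_iff_le_comap]
      intro y hy
      have hy' : (j.stalkMap x).hom y ∈ Ideal.span (Set.range cb) := by
        rw [hcb]
        exact map_nonunit (j.stalkMap x).hom y hy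
      have hrange : (Set.range cb) = (j.stalkMap x).hom '' Set.range ct := by
        ext z; constructor
        · rintro ⟨i, rfl⟩; exact ⟨ct i, ⟨i, rfl⟩, hct i⟩
        · rintro ⟨_, ⟨i, rfl⟩, rfl⟩; exact ⟨i, (hct i).symm⟩
      rw [hrange, ← Ideal.map_span, Ideal.mem_map_iff_of_surjective _ (stalkMap_model_surjective θ hθ r' j t hsq x)] at hy'
      obtain ⟨z, hz, hzy⟩ := hy'
      have hdiff : y - z ∈ Ideal.span {ϖR} := by
        rw [← hkerj, RingHom.mem_ker, map_sub, hzy, sub_self]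
      rw [Ideal.mem_comap, show y = z + (y - z) by ring, map_add,
        Ideal.Quotient.eq_zero_iff_mem.mpr hdiff, add_zero]
      have : Ideal.span (Set.range ct) ≤ (Ideal.span (Set.range fun i => Ideal.Quotient.mk (Ideal.span {ϖR}) (ct i))).comap
          (Ideal.Quotient.mk (Ideal.span {ϖR})) := by
        rw [Ideal.span_le]
        rintro _ ⟨i, rfl⟩
        exact Ideal.subset_span ⟨i, rfl⟩
      exact this hz
  obtain ⟨c, -, hcmod, hcI⟩ := exists_frame_lift_of_torsionFree hIfg hsup htf _ hcb'
  refine ⟨c, hcI, fun i => ?_⟩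
  have hdiff : c i - ct i ∈ RingHom.ker (j.stalkMap x).hom := by
    rw [hkerj, ← Ideal.Quotient.eq, hcmod]
  rw [RingHom.mem_ker, map_sub, sub_eq_zero] at hdiff
  rw [hdiff, hct]

/-! ## (c) A cluster member on the carrier curve has order `≥ 1` -/

/-- `coeff 0 (F(T + a)) = F(a)`. [folklore] -/
theorem coeff_zero_aeval_X_add_C {R : Type*} [CommRing R] {τ : Type*} (a : τ → R) (F : MvPolynomial τ R) :
    coeff 0 (aeval (fun l : τ => (X l : MvPolynomial τ R) + C (a l)) F) = MvPolynomial.eval a F := by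
  rw [← constantCoeff_eq, show constantCoeff (aeval (fun l : τ => (X l : MvPolynomial τ R) + C (a l)) F) =
    (constantCoeff.comp (aeval (fun l : τ => (X l : MvPolynomial τ R) + C (a l))).toRingHom) F from rfl]
  congr 1
  refine MvPolynomial.ringHom_ext (fun r => ?_) (fun l => ?_)
  · simp
  · simp

variable {F₁ F₂ : Scheme.{0}} {υ : F₂ ⟶ F₁} {x : F₁}

set_option maxHeartbeats 800000 in -- subalgebra-of-localisation instances are slow (cf. p526020)
/-- **A cluster member lying on the carrier curve has exact order `≥ 1`.** Setting of res-L1-w45b-stub-2's `finite_badPrimes…` (frame `c̄`,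
residue model `πk`, `𝓘(W̄)_x = (Φ(c̄))`, `G` with (R1)/(R2), `ḡ = πk_* G`); a point `y′` over `x` presented on the chart `c̄_i` at a prime `𝔮`
with coordinates `w` lifting `a`, lying on `Z₂ = υ⁻¹{x} ∩ closure υ⁻¹(W̄ ∖ {x})`; then `ḡ(T_i := 1) ∈ (T_l − a_l)_l`, so the exponent `m` of an
exact-order clause `ḡ(T_i := 1) ∈ 𝔪_a^m ∖ 𝔪_a^{m+1}` is `≥ 1`. [cite: StacksProject, Tag 0804] [OURS · L1 W4.5b] (δ) D6 prep. -/
theorem one_le_of_clusterPoint_mem_carrierTrace [IsLocallyNoetherian F₂] (hx : IsClosed ({x} : Set F₁))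
    (c : Fin 3 → F₁.presheaf.stalk x) (hc𝔪 : Ideal.span (Set.range c) = maximalIdeal (F₁.presheaf.stalk x))
    (hc : IsQuasiRegular c) {k' : Type} [Field k'] (πk : F₁.presheaf.stalk x →+* k')
    (hkerπ : RingHom.ker πk = Ideal.span (Set.range c)) (W : Closeds F₁) {d : ℕ}
    (Φ G : MvPolynomial (Fin 3) (F₁.presheaf.stalk x))
    (hΦd : Φ.IsHomogeneous d) (hΦ : MvPolynomial.map (Ideal.Quotient.mk (Ideal.span (Set.range c))) Φ ≠ 0)
    (hW : stalkIdeal (vanishingIdeal W) x = Ideal.span {MvPolynomial.eval c Φ})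
    (hΦG : MvPolynomial.map (Ideal.Quotient.mk (Ideal.span (Set.range c))) Φ ∈
      (Ideal.span {MvPolynomial.map (Ideal.Quotient.mk (Ideal.span (Set.range c))) G}).radical)
    (hGΦ : MvPolynomial.map (Ideal.Quotient.mk (Ideal.span (Set.range c))) G ∈
      (Ideal.span {MvPolynomial.map (Ideal.Quotient.mk (Ideal.span (Set.range c))) Φ}).radical)
    (hGrad : ∀ j, (Ideal.span {MvPolynomial.map (Ideal.Quotient.mk (Ideal.span (Set.range c)))
      (dehomogenize j G)}).IsRadical)
    (hZ : IsClosed (υ ⁻¹' {x} ∩ closure (υ ⁻¹' ((W : Set F₁) \ {x}))))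
    (i : Fin 3) (a : {l : Fin 3 // l ≠ i} → k') (m : ℕ)
    (hord : dehomogenize i (MvPolynomial.map πk G) ∉
      (Ideal.span (Set.range fun l => (X l : MvPolynomial {l : Fin 3 // l ≠ i} k') - C (a l))) ^ (m + 1))
    (y' : F₂) (hy'x : υ y' = x)
    (𝔮 : PrimeSpectrum (blowupAlgebra (Ideal.span (Set.range c)) (c i)))
    (χ : blowupAlgebra (Ideal.span (Set.range c)) (c i) →+* F₂.presheaf.stalk y')
    (hχ : ∀ r, χ (algebraMap _ _ r) = ((F₁.presheaf.stalkCongr (.of_eq hy'x)).inv ≫ υ.stalkMap y').hom r)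
    (hloc : @IsLocalization.AtPrime _ _ (F₂.presheaf.stalk y') _ χ.toAlgebra 𝔮.asIdeal _)
    (h𝔮 : 𝔮.asIdeal.comap (algebraMap _ (blowupAlgebra (Ideal.span (Set.range c)) (c i))) = maximalIdeal (F₁.presheaf.stalk x))
    (w : {l : Fin 3 // l ≠ i} → F₁.presheaf.stalk x) (hw : ∀ l, πk (w l) = a l)
    (hfr : ∀ l : {l : Fin 3 // l ≠ i}, blowupAlgebra.frac c i l.1 - algebraMap _ _ (w l) ∈ 𝔮.asIdeal)
    (hy'Z : y' ∈ υ ⁻¹' {x} ∩ closure (υ ⁻¹' ((W : Set F₁) \ {x}))) : 1 ≤ m := by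
  classical
  set Zi := vanishingIdeal (⟨υ ⁻¹' {x} ∩ closure (υ ⁻¹' ((W : Set F₁) \ {x})), hZ⟩ : Closeds F₂) with hZi
  -- the presentation in the `e`/`.hom` currency of the trace lemma
  letI algχ := χ.toAlgebra
  haveI : IsLocalization.AtPrime (F₂.presheaf.stalk y') 𝔮.asIdeal := hloc
  let eA : F₂.presheaf.stalk y' ≃ₐ[blowupAlgebra (Ideal.span (Set.range c)) (c i)] Localization.AtPrime 𝔮.asIdeal :=
    IsLocalization.algEquiv 𝔮.asIdeal.primeCompl _ _
  have he : ∀ b, eA.toRingEquiv (χ b) = algebraMap _ (Localization.AtPrime 𝔮.asIdeal) b := fun b => eA.commutes b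
  have hχhom : ∀ r, χ (algebraMap _ _ r) = (υ.stalkMap y').hom ((F₁.presheaf.stalkCongr (.of_eq hy'x.symm)).hom r) :=
    fun r => (hχ r).trans (stalkCongr_inv_comp_apply_eq hy'x r)
  -- `y′ ∈ Z₂ = supp 𝓘(Z₂)` ⇒ `G_i ∈ 𝔮`
  have hsupp : y' ∈ Zi.support := by
    rw [← SetLike.mem_coe, hZi, Scheme.IdealSheafData.coe_support_vanishingIdeal]; exact hy'Z
  have hst := stalkIdeal_carrierTrace_of_presentation' hx y' hy'x c hc𝔪 hc W Φ G hΦd hΦ hW hΦG hGΦ hGrad hZ i 𝔮 χ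
    eA.toRingEquiv hχhom he
  have hG𝔮 : MvPolynomial.aeval (blowupAlgebra.frac c i) G ∈ 𝔮.asIdeal := by
    have h := (mem_support_iff_stalkIdeal_le Zi y').mp hsupp
    rw [← hZi] at hst
    rw [hst, sup_le_iff, Ideal.span_singleton_le_iff_mem] at h
    exact (mem_chartPrime_iff_apply_mem_maximalIdeal 𝔮 χ hloc _).mpr h.1
  -- hence `ḡ(T_i := 1)(a) = 0`
  rw [coneTransform_eq_aeval_dehomogenize] at hG𝔮
  have h1 := (eval_mem_iff_of_forall_frac_sub_mem c i 𝔮.asIdeal h𝔮 w hfr (dehomogenize i G)).mp hG𝔮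
  rw [← hc𝔪, ← hkerπ, RingHom.mem_ker, ringHom_eval_eq_eval_map, map_dehomogenize,
    show (fun l => πk (w l)) = a from funext hw] at h1
  -- so `ḡ(T_i := 1) ∈ 𝔪_a`, contradicting an exact order `m = 0`
  by_contra hm
  have hm0 : m = 0 := by omega
  apply hord
  rw [hm0, zero_add, mem_pow_span_X_sub_C_iff]
  intro α hα
  have hα0 : α = 0 := by
    have : α.degree = 0 := by omega
    exact (Finsupp.degree_eq_zero_iff α).mp this
  rw [hα0, coeff_zero_aeval_X_add_C]
  exact h1

end Summit.ResolutionOfSingularities.ResolutionOfSingularities.Cruxes.EquisingularLiftNat.Sections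

end
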